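import Summits.CriticalPhenomena.PercolationContinuityZ3.Theorems.PercNearOneGluingNoHeavyLowerTailIncStarTwoCutGlue
import Summits.CriticalPhenomena.PercolationContinuityZ3.Theorems.PercNearOneGluingNoHeavyLowerTailIncStarTwoCutNearTheta
import Summits.CriticalPhenomena.PercolationContinuityZ3.Theorems.PercNearOneGluingNoHeavyLowerTailIncStarTwoCutNearRowsFour
import Summits.CriticalPhenomena.PercolationContinuityZ3.Theorems.PercNearOneGluingNoHeavyLowerTailIncStarTwoCutNearRowXY
import Summits.CriticalPhenomena.PercolationContinuityZ3.Theorems.PercNearOneGluingNoHeavyLowerTailIncStarTwoCutNearPos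
import Mathlib.Tactic.FieldSimp
import HarnessLib

/-!
# Two-cuts with the root and one target on the root side (MODE B), XII: the near rows on the root side; THEOREM B⁺ ⟸ the STAR row

Support file for the Sahi programme (`--supports stmt-CriticalPhenomena-4575`, prover prim-sahi-p2 gen 27).  No definitions, no named facts,
no sorries; standard axioms.  Memos `…/FROM-prim-sahi-p2-gen26-NEAR-LEMMA.md`, `…/FROM-prim-sahi-p2-gen27-BPLUS-GLUE-M8.md` §2(b).
Part XI (`incStar_nonneg_of_twoCut_rootSideTarget`) takes the eight cone rows of (N⁺) as hypotheses; seven are theorems of the near side alone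
(parts IV–IX, standalone graph).  `real_rootSide_eq_restrict`: `P_w(ω ∩ F ∈ E) = P_{w·1_F}(E)`; with the restricted weight, `near_row_X`,
`near_row_XY`, `near_harris_rows`, `near_theta_le_tau`, division by the loner probabilities and `near_theta_rows` give `twoCut_near_rows`
(hN1–hN7 for `θu = dY/qY`, `θv = dX/qX`), hence `incStar_nonneg_of_twoCut_rootSideTarget_of_starRow`: **THEOREM B⁺ ⟸ the single STAR row
hN8 (= (N8) ⟸ (V2), open) + the two moved-target stars**, for `s, u, v` distinct and non-null loner/separation events.
-/

noncomputable section

namespace Summit.CriticalPhenomena.PercolationContinuityZ3.Theorems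

namespace IncStarTwoCut

open MeasureTheory Set Literature.Probability.Percolation Literature.Probability.LatticeModels
open IncStarOneTargetSide
open scoped Classical

variable {n : ℕ}

/-! ### Transfer of the near rows (N1)–(N7) from a standalone near graph to the root-side pairs of the two-cut -/

section Transfer

/-- Division helper: `E·P ≤ R·D` with `D > 0` gives `(E/D)·P ≤ R`. [folklore] -/
theorem div_row {D E P R : ℝ} (hD : 0 < D) (h : E * P ≤ R * D) : E / D * P ≤ R := by
  rw [div_mul_eq_mul_div, div_le_iff₀ hD]; exact h

/-- Division helper: `E_u D_v P + E_v D_u Q ≤ D_u D_v R` with `D_u, D_v > 0` gives `(E_u/D_u)·P + (E_v/D_v)·Q ≤ R`. [folklore] -/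
theorem div_rows {Du Dv Eu Ev P Q R : ℝ} (hDu : 0 < Du) (hDv : 0 < Dv) (h : Eu * Dv * P + Ev * Du * Q ≤ Du * Dv * R) :
    Eu / Du * P + Ev / Dv * Q ≤ R := by
  have hne_u : Du ≠ 0 := ne_of_gt hDu
  have hne_v : Dv ≠ 0 := ne_of_gt hDv
  rw [div_mul_eq_mul_div, div_mul_eq_mul_div, div_add_div _ _ hne_u hne_v, div_le_iff₀ (mul_pos hDu hDv)]
  nlinarith [h]

/-- **Restriction to the root-side pairs.**  For every event `E`, the probability that the ROOT-SIDE configuration `ω ∩ F` lies in `E` under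
`prodBernoulli w` equals the probability of `E` under the weight restricted to `F` (`w` on `F`, `0` elsewhere). [folklore] -/
theorem real_rootSide_eq_restrict (w : Sym2 (Fin n) → unitInterval) (F : Set (Sym2 (Fin n))) (E : Set (BondConfig (Fin n))) :
    (prodBernoulli w).real {ω | ω ∩ F ∈ E} = (prodBernoulli (fun e => if e ∈ F then w e else 0)).real E := by
  have hmeas : ∀ X : Set (BondConfig (Fin n)), MeasurableSet X := fun _ => MeasurableSet.of_discrete
  set wF : Sym2 (Fin n) → unitInterval := fun e => if e ∈ F then w e else 0 with hwF
  -- (1) under `wF` the pairs outside `F` are a.s. closed, so `ω ∩ F = ω` a.s.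
  set G : Set (BondConfig (Fin n)) := {ω | ∀ e, wF e = 0 → e ∉ ω}
  have hG1 : (prodBernoulli wF).real G = 1 := IncStar.real_sureClosed wF
  have hGF : ∀ ω ∈ G, ω ∩ F = ω := by
    intro ω hω
    ext e
    simp only [Set.mem_inter_iff]
    constructor
    · exact fun h => h.1
    · intro he
      refine ⟨he, ?_⟩
      by_contra heF
      exact hω e (by simp [hwF, heF]) he
  have h1 : (prodBernoulli wF).real E = (prodBernoulli wF).real {ω | ω ∩ F ∈ E} := by
    rw [IncStar.real_eq_real_inter_of_real_eq_one (hmeas G) hG1 E,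
      IncStar.real_eq_real_inter_of_real_eq_one (hmeas G) hG1 {ω | ω ∩ F ∈ E}]
    congr 1
    ext ω
    simp only [Set.mem_inter_iff, Set.mem_setOf_eq]
    constructor
    · rintro ⟨hE, hω⟩; exact ⟨by rw [hGF ω hω]; exact hE, hω⟩
    · rintro ⟨hE, hω⟩; exact ⟨by rw [← hGF ω hω]; exact hE, hω⟩
  -- (2) the root-side event is determined by `F`, where `wF = w`
  have hdet : DeterminedBy {ω : BondConfig (Fin n) | ω ∩ F ∈ E} F :=
    (determinedBy_iff _ _).2 fun ω ω' h => by simp only [Set.mem_setOf_eq, h]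
  have hagree : ∀ e ∈ F, wF e = w e := fun e he => by simp [hwF, he]
  rw [h1]
  exact (prodBernoulli_real_eq_of_determinedBy wF w hagree hdet (hmeas _)).symm

variable {s u v a : Fin n}

/-- Class `X` in two vocabularies: `{s↔u} ∖ {s↔v} = {u↔s} ∩ {u↮v}`. [folklore] -/
theorem classX_eq (s u v : Fin n) :
    (openConn s u \ openConn s v : Set (BondConfig (Fin n))) = openConn u s ∩ (openConn u v)ᶜ := by
  ext ω
  simp only [Set.mem_sdiff, Set.mem_inter_iff, Set.mem_compl_iff]
  constructor
  · rintro ⟨h1, h2⟩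
    exact ⟨SimpleGraph.Reachable.symm h1, fun h => h2 (SimpleGraph.Reachable.trans h1 h)⟩
  · rintro ⟨h1, h2⟩
    exact ⟨SimpleGraph.Reachable.symm h1, fun h => h2 (SimpleGraph.Reachable.trans h1 h)⟩

/-- The `X`-part of the target: `{s↔a} ∩ ({s↔u} ∖ {s↔v}) = {u↔a} ∩ {u↔s} ∩ {u↮v}`. [folklore] -/
theorem targetX_eq (s u v a : Fin n) :
    (openConn s a ∩ (openConn s u \ openConn s v) : Set (BondConfig (Fin n))) = openConn u a ∩ openConn u s ∩ (openConn u v)ᶜ := by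
  ext ω
  simp only [Set.mem_sdiff, Set.mem_inter_iff, Set.mem_compl_iff]
  constructor
  · rintro ⟨ha, hu, hv⟩
    exact ⟨⟨(SimpleGraph.Reachable.symm hu).trans ha, SimpleGraph.Reachable.symm hu⟩, fun h => hv (SimpleGraph.Reachable.trans hu h)⟩
  · rintro ⟨⟨ha, hu⟩, hv⟩
    exact ⟨(SimpleGraph.Reachable.symm hu).trans ha, SimpleGraph.Reachable.symm hu, fun h => hv (SimpleGraph.Reachable.trans hu h)⟩

/-- Class `Y` against the loner set of `u`: `{u↮s} ∩ {u↮v} ∩ {s↔v} = {s↔v} ∖ {s↔u}`. [folklore] -/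
theorem Du_inter_Y_eq (s u v : Fin n) :
    ((openConn u s)ᶜ ∩ (openConn u v)ᶜ ∩ openConn s v : Set (BondConfig (Fin n))) = openConn s v \ openConn s u := by
  ext ω
  simp only [Set.mem_sdiff, Set.mem_inter_iff, Set.mem_compl_iff]
  constructor
  · rintro ⟨⟨h1, -⟩, h3⟩
    exact ⟨h3, fun h => h1 (SimpleGraph.Reachable.symm h)⟩
  · rintro ⟨h3, h1⟩
    exact ⟨⟨fun h => h1 (SimpleGraph.Reachable.symm h), fun h => h1 (h3.trans (SimpleGraph.Reachable.symm h))⟩, h3⟩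

/-- The port-swap event: `(({s↔a} ∪ {u↔a}) ∩ ({s↔v} ∖ {s↔u})) ∖ ({s↔a} ∩ ({s↔v} ∖ {s↔u})) = {u↮s} ∩ {u↮v} ∩ ({u↔a} ∩ {s↔v})`
("`a` hangs at `u` while `s` is joined to `v` only"). [this work] -/
theorem portSwap_eq (s u v a : Fin n) :
    (((openConn s a ∪ openConn u a) ∩ (openConn s v \ openConn s u)) \ (openConn s a ∩ (openConn s v \ openConn s u)) : Set (BondConfig (Fin n)))
      = (openConn u s)ᶜ ∩ (openConn u v)ᶜ ∩ (openConn u a ∩ openConn s v) := by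
  ext ω
  simp only [Set.mem_sdiff, Set.mem_inter_iff, Set.mem_union, Set.mem_compl_iff]
  constructor
  · rintro ⟨⟨hA, hv, hu⟩, hnot⟩
    have hsa : ω ∉ openConn s a := fun h => hnot ⟨h, hv, hu⟩
    have hua : ω ∈ openConn u a := by
      rcases hA with h | h
      · exact absurd h hsa
      · exact h
    exact ⟨⟨fun h => hu (SimpleGraph.Reachable.symm h), fun h => hu (SimpleGraph.Reachable.trans hv (SimpleGraph.Reachable.symm h))⟩, hua, hv⟩
  · rintro ⟨⟨h1, h2⟩, hua, hv⟩
    refine ⟨⟨Or.inr hua, hv, fun h => h1 (SimpleGraph.Reachable.symm h)⟩, ?_⟩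
    rintro ⟨hsa, -, -⟩
    exact h1 ((SimpleGraph.Reachable.trans hsa (SimpleGraph.Reachable.symm hua)).symm)

/-- The all-separated event in two arrangements. [folklore] -/
theorem allSep_comm (s u v : Fin n) :
    ((openConn s u)ᶜ ∩ (openConn s v)ᶜ ∩ (openConn u v)ᶜ : Set (BondConfig (Fin n))) = (openConn u v)ᶜ ∩ (openConn u s)ᶜ ∩ (openConn v s)ᶜ := by
  ext ω
  simp only [Set.mem_inter_iff, Set.mem_compl_iff]
  constructor
  · rintro ⟨⟨h1, h2⟩, h3⟩
    exact ⟨⟨h3, fun h => h1 (SimpleGraph.Reachable.symm h)⟩, fun h => h2 (SimpleGraph.Reachable.symm h)⟩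
  · rintro ⟨⟨h3, h1⟩, h2⟩
    exact ⟨⟨fun h => h1 (SimpleGraph.Reachable.symm h), fun h => h2 (SimpleGraph.Reachable.symm h)⟩, h3⟩

end Transfer

section NearRows

set_option maxHeartbeats 1600000 in
/-- **The near rows (N1)–(N7) on the root side of the two-cut.**  In the setting of `incStar_nonneg_of_twoCut_rootSideTarget`, with `s, u, v`
distinct and the three loner/separation events of the root-side graph non-null (`P(u ↮ s, u ↮ v) > 0`, `P(v ↮ s, v ↮ u) > 0`,
`P(s, u, v pairwise separated) > 0`, root-side pairs only), the coefficients `θu := dY/qY`, `θv := dX/qX` satisfy `θ ≥ 0`, `θu·qY = dY`, `θv·qX = dX`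
and the seven cone rows hN1–hN7.  Proof: restrict the weight to the root-side pairs (`real_rootSide_eq_restrict`), apply gen 26's `near_row_X` (×2),
`near_row_XY`, `near_harris_rows` (×4) and `near_theta_le_tau` (×2) to the restricted weight, divide by the loner probabilities, and repackage with
`near_theta_rows`. [this work] -/
theorem twoCut_near_rows (w : Sym2 (Fin n) → unitInterval) {s u v a : Fin n}
    (hus : u ≠ s) (hvs : v ≠ s) (huv : u ≠ v)
    (F : Set (Sym2 (Fin n)))
    {Xu Xv Ba Va Ua : Set (BondConfig (Fin n))}
    (hXu : Xu = {ω | ω ∩ F ∈ (openConn s u : Set (BondConfig (Fin n)))})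
    (hXv : Xv = {ω | ω ∩ F ∈ (openConn s v : Set (BondConfig (Fin n)))})
    (hBa : Ba = {ω | ω ∩ F ∈ (openConn s a : Set (BondConfig (Fin n)))})
    (hVa : Va = {ω | ω ∩ F ∈ (openConn v a : Set (BondConfig (Fin n)))})
    (hUa : Ua = {ω | ω ∩ F ∈ (openConn u a : Set (BondConfig (Fin n)))})
    {qX qY qW a0 aX aY aW dX dY : ℝ}
    (hqX : qX = (prodBernoulli w).real (Xu \ Xv)) (hqY : qY = (prodBernoulli w).real (Xv \ Xu))
    (hqW : qW = (prodBernoulli w).real (Xu ∩ Xv))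
    (ha0 : a0 = (prodBernoulli w).real (Ba ∩ (Xu ∪ Xv)ᶜ)) (haX : aX = (prodBernoulli w).real (Ba ∩ (Xu \ Xv)))
    (haY : aY = (prodBernoulli w).real (Ba ∩ (Xv \ Xu))) (haW : aW = (prodBernoulli w).real (Ba ∩ (Xu ∩ Xv)))
    (hdX : dX = (prodBernoulli w).real ((Ba ∪ Va) ∩ (Xu \ Xv)) - (prodBernoulli w).real (Ba ∩ (Xu \ Xv)))
    (hdY : dY = (prodBernoulli w).real ((Ba ∪ Ua) ∩ (Xv \ Xu)) - (prodBernoulli w).real (Ba ∩ (Xv \ Xu)))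
    (hDu : 0 < (prodBernoulli w).real {ω | ω ∩ F ∈ ((openConn u s)ᶜ ∩ (openConn u v)ᶜ : Set (BondConfig (Fin n)))})
    (hDv : 0 < (prodBernoulli w).real {ω | ω ∩ F ∈ ((openConn v s)ᶜ ∩ (openConn v u)ᶜ : Set (BondConfig (Fin n)))})
    (hD0 : 0 < (prodBernoulli w).real {ω | ω ∩ F ∈ ((openConn s u)ᶜ ∩ (openConn s v)ᶜ ∩ (openConn u v)ᶜ : Set (BondConfig (Fin n)))}) :
    (0 ≤ dY / qY) ∧ (0 ≤ dX / qX) ∧ (dY / qY * qY = dY) ∧ (dX / qX * qX = dX) ∧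
    (0 ≤ aX - dY / qY * qX) ∧ (0 ≤ aY - dX / qX * qY) ∧ (0 ≤ aW - (dY / qY + dX / qX) * qW) ∧
    ((qX + qW) * (a0 + aX + aY + aW - dY / qY * (qX + qW) - dX / qX * (qY + qW)) ≤ (aX - dY / qY * qX) + (aW - (dY / qY + dX / qX) * qW)) ∧
    ((qY + qW) * (a0 + aX + aY + aW - dY / qY * (qX + qW) - dX / qX * (qY + qW)) ≤ (aY - dX / qX * qY) + (aW - (dY / qY + dX / qX) * qW)) ∧
    ((qX + qW + (qY + qW) - qW) * (a0 + aX + aY + aW - dY / qY * (qX + qW) - dX / qX * (qY + qW))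
      ≤ (aX - dY / qY * qX) + (aY - dX / qX * qY) + (aW - (dY / qY + dX / qX) * qW)) ∧
    (qW * (a0 + aX + aY + aW - dY / qY * (qX + qW) - dX / qX * (qY + qW)) ≤ aW - (dY / qY + dX / qX) * qW) := by
  have hmeas : ∀ X : Set (BondConfig (Fin n)), MeasurableSet X := fun _ => MeasurableSet.of_discrete
  subst hXu hXv hBa hVa hUa
  set wF : Sym2 (Fin n) → unitInterval := fun e => if e ∈ F then w e else 0 with hwF
  set μ := prodBernoulli w with hμ
  set ν := prodBernoulli wF with hν
  have T : ∀ E : Set (BondConfig (Fin n)), μ.real {ω | ω ∩ F ∈ E} = ν.real E := fun E => real_rootSide_eq_restrict w F E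
  set SU : Set (BondConfig (Fin n)) := openConn s u with hSU
  set SV : Set (BondConfig (Fin n)) := openConn s v with hSV
  set SA : Set (BondConfig (Fin n)) := openConn s a with hSA
  set UA : Set (BondConfig (Fin n)) := openConn u a with hUA
  set VA : Set (BondConfig (Fin n)) := openConn v a with hVA
  set DU : Set (BondConfig (Fin n)) := (openConn u s)ᶜ ∩ (openConn u v)ᶜ with hDU
  set DV : Set (BondConfig (Fin n)) := (openConn v s)ᶜ ∩ (openConn v u)ᶜ with hDV
  have rqX : qX = ν.real (SU \ SV) := by rw [hqX, ← T]; rfl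
  have rqY : qY = ν.real (SV \ SU) := by rw [hqY, ← T]; rfl
  have rqW : qW = ν.real (SU ∩ SV) := by rw [hqW, ← T]; rfl
  have ra0 : a0 = ν.real (SA ∩ (SU ∪ SV)ᶜ) := by rw [ha0, ← T]; rfl
  have raX : aX = ν.real (SA ∩ (SU \ SV)) := by rw [haX, ← T]; rfl
  have raY : aY = ν.real (SA ∩ (SV \ SU)) := by rw [haY, ← T]; rfl
  have raW : aW = ν.real (SA ∩ (SU ∩ SV)) := by rw [haW, ← T]; rfl
  have rDu : 0 < ν.real DU := by rw [← T]; exact hDu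
  have rDv : 0 < ν.real DV := by rw [← T]; exact hDv
  have rD0 : 0 < ν.real ((SU)ᶜ ∩ (SV)ᶜ ∩ (openConn u v)ᶜ) := by rw [← T]; exact hD0
  have rdY : dY = ν.real (DU ∩ (UA ∩ SV)) := by
    rw [hdY, ← portSwap_eq s u v a, ← T]
    have hsub : {ω : BondConfig (Fin n) | ω ∩ F ∈ (SA ∩ (SV \ SU) : Set (BondConfig (Fin n)))}
        ⊆ {ω | ω ∩ F ∈ ((SA ∪ UA) ∩ (SV \ SU) : Set (BondConfig (Fin n)))} := fun ω h => ⟨Or.inl h.1, h.2⟩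
    have h := measureReal_inter_add_sdiff (μ := μ) (s := {ω : BondConfig (Fin n) | ω ∩ F ∈ ((SA ∪ UA) ∩ (SV \ SU) : Set (BondConfig (Fin n)))})
      (hmeas {ω : BondConfig (Fin n) | ω ∩ F ∈ (SA ∩ (SV \ SU) : Set (BondConfig (Fin n)))})
    rw [Set.inter_eq_self_of_subset_right hsub] at h
    have e : ({ω : BondConfig (Fin n) | ω ∩ F ∈ ((SA ∪ UA) ∩ (SV \ SU) : Set (BondConfig (Fin n)))}
        \ {ω | ω ∩ F ∈ (SA ∩ (SV \ SU) : Set (BondConfig (Fin n)))})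
        = {ω | ω ∩ F ∈ (((SA ∪ UA) ∩ (SV \ SU)) \ (SA ∩ (SV \ SU)) : Set (BondConfig (Fin n)))} := rfl
    rw [e] at h
    show μ.real {ω | ω ∩ F ∈ ((SA ∪ UA) ∩ (SV \ SU) : Set (BondConfig (Fin n)))} - μ.real {ω | ω ∩ F ∈ (SA ∩ (SV \ SU) : Set (BondConfig (Fin n)))}
      = μ.real {ω | ω ∩ F ∈ (((SA ∪ UA) ∩ (SV \ SU)) \ (SA ∩ (SV \ SU)) : Set (BondConfig (Fin n)))}
    linarith [h]
  have rdX : dX = ν.real (DV ∩ (VA ∩ SU)) := by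
    rw [hdX, ← portSwap_eq s v u a, ← T]
    have hsub : {ω : BondConfig (Fin n) | ω ∩ F ∈ (SA ∩ (SU \ SV) : Set (BondConfig (Fin n)))}
        ⊆ {ω | ω ∩ F ∈ ((SA ∪ VA) ∩ (SU \ SV) : Set (BondConfig (Fin n)))} := fun ω h => ⟨Or.inl h.1, h.2⟩
    have h := measureReal_inter_add_sdiff (μ := μ) (s := {ω : BondConfig (Fin n) | ω ∩ F ∈ ((SA ∪ VA) ∩ (SU \ SV) : Set (BondConfig (Fin n)))})
      (hmeas {ω : BondConfig (Fin n) | ω ∩ F ∈ (SA ∩ (SU \ SV) : Set (BondConfig (Fin n)))})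
    rw [Set.inter_eq_self_of_subset_right hsub] at h
    have e : ({ω : BondConfig (Fin n) | ω ∩ F ∈ ((SA ∪ VA) ∩ (SU \ SV) : Set (BondConfig (Fin n)))}
        \ {ω | ω ∩ F ∈ (SA ∩ (SU \ SV) : Set (BondConfig (Fin n)))})
        = {ω | ω ∩ F ∈ (((SA ∪ VA) ∩ (SU \ SV)) \ (SA ∩ (SU \ SV)) : Set (BondConfig (Fin n)))} := rfl
    rw [e] at h
    show μ.real {ω | ω ∩ F ∈ ((SA ∪ VA) ∩ (SU \ SV) : Set (BondConfig (Fin n)))} - μ.real {ω | ω ∩ F ∈ (SA ∩ (SU \ SV) : Set (BondConfig (Fin n)))}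
      = μ.real {ω | ω ∩ F ∈ (((SA ∪ VA) ∩ (SU \ SV)) \ (SA ∩ (SU \ SV)) : Set (BondConfig (Fin n)))}
    linarith [h]
  have xbar : ν.real SU = qX + qW := by rw [rqX, rqW]; exact real_sdiff_add_inter SU SV
  have ybar : ν.real SV = qY + qW := by rw [rqY, rqW, Set.inter_comm]; exact real_sdiff_add_inter SV SU
  have ubar : ν.real (SU ∪ SV) = qX + qY + qW := by rw [rqX, rqY, rqW]; exact real_union_three SU SV
  have AX : ν.real (SA ∩ SU) = aX + aW := by
    rw [raX, raW, ← Set.inter_sdiff_assoc, ← Set.inter_assoc]; exact real_sdiff_add_inter (SA ∩ SU) SV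
  have AY : ν.real (SA ∩ SV) = aY + aW := by
    rw [raY, raW, ← Set.inter_sdiff_assoc, Set.inter_comm SU SV, ← Set.inter_assoc]; exact real_sdiff_add_inter (SA ∩ SV) SU
  have AW : ν.real (SA ∩ (SU ∩ SV)) = aW := raW.symm
  have AU : ν.real (SA ∩ (SU ∪ SV)) = aX + aY + aW := by
    have h := measureReal_union_add_inter (μ := ν) (s := SA ∩ SU) (t := SA ∩ SV) (hmeas _)
    rw [← Set.inter_union_distrib_left, show SA ∩ SU ∩ (SA ∩ SV) = SA ∩ (SU ∩ SV) by
      ext ω; simp only [Set.mem_inter_iff]; tauto, AX, AY, AW] at h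
    linarith
  have AL : ν.real SA = a0 + aX + aY + aW := by
    have h := real_sdiff_add_inter (μ := ν) SA (SU ∪ SV)
    rw [AU, show SA \ (SU ∪ SV) = SA ∩ (SU ∪ SV)ᶜ from Set.sdiff_eq _ _, ← ra0] at h
    linarith
  have n1 := near_row_X wF s u v a
  rw [← hν, Set.inter_comm (openConn u a) _, show (openConn u s ∩ (openConn u v)ᶜ : Set (BondConfig (Fin n))) = SU \ SV from
    (classX_eq s u v).symm, ← rqX, show (openConn u a ∩ openConn u s ∩ (openConn u v)ᶜ : Set (BondConfig (Fin n))) = SA ∩ (SU \ SV) from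
    (targetX_eq s u v a).symm, ← raX] at n1
  have n2 := near_row_X wF s v u a
  rw [← hν, Set.inter_comm (openConn v a) _, show (openConn v s ∩ (openConn v u)ᶜ : Set (BondConfig (Fin n))) = SV \ SU from
    (classX_eq s v u).symm, ← rqY, show (openConn v a ∩ openConn v s ∩ (openConn v u)ᶜ : Set (BondConfig (Fin n))) = SA ∩ (SV \ SU) from
    (targetX_eq s v u a).symm, ← raY] at n2
  have n3 := near_row_XY wF s u v a hus.symm hvs.symm huv rD0
  rw [← hν, ← rqW, Set.inter_comm (SU ∩ SV) SA, AW] at n3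
  have t1 := near_theta_le_tau wF s u v a hus huv
  rw [← hν, ← rdY, Du_inter_Y_eq s u v, ← rqY] at t1
  have t2 := near_theta_le_tau wF s v u a hvs (Ne.symm huv)
  rw [← hν, ← rdX, Du_inter_Y_eq s v u, ← rqX] at t2
  have rD0' : 0 < ν.real ((openConn u v)ᶜ ∩ (openConn u s)ᶜ ∩ (openConn v s)ᶜ : Set (BondConfig (Fin n))) := by
    rw [← allSep_comm s u v]; exact rD0
  have hr := fun J hJ => near_harris_rows wF s u v a hus hvs huv rDu rDv rD0' J hJ
  have h4 := hr SU (Or.inl rfl)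
  have h5 := hr SV (Or.inr (Or.inl rfl))
  have h6 := hr (SU ∪ SV) (Or.inr (Or.inr (Or.inl rfl)))
  have h7 := hr (SU ∩ SV) (Or.inr (Or.inr (Or.inr rfl)))
  simp only [← hν] at h4 h5 h6 h7
  rw [Set.inter_self, Set.inter_comm SV SU, ← rqW, xbar, ybar, AX] at h4
  rw [Set.inter_self, xbar, ybar, ← rqW, AY] at h5
  rw [Set.inter_eq_left.2 Set.subset_union_left, Set.inter_eq_left.2 Set.subset_union_right, xbar, ybar, ubar, AU] at h6
  rw [← Set.inter_assoc, Set.inter_self, show (SV ∩ (SU ∩ SV) : Set (BondConfig (Fin n))) = SU ∩ SV by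
      rw [Set.inter_comm SU SV, ← Set.inter_assoc, Set.inter_self], ← rqW, xbar, ybar, AW, AL] at h7
  rw [AL] at h4 h5 h6
  set Du := ν.real DU with hDud
  set Dv := ν.real DV with hDvd
  set Eu := ν.real (DU ∩ UA) with hEud
  set Ev := ν.real (DV ∩ VA) with hEvd
  set τu := Eu / Du with hτu
  set τv := Ev / Dv with hτv
  have hqX0 : 0 ≤ qX := by rw [hqX]; exact measureReal_nonneg
  have hqY0 : 0 ≤ qY := by rw [hqY]; exact measureReal_nonneg
  have hqW0 : 0 ≤ qW := by rw [hqW]; exact measureReal_nonneg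
  have ha00 : 0 ≤ a0 := by rw [ha0]; exact measureReal_nonneg
  have hdY0 : 0 ≤ dY := by rw [rdY]; exact measureReal_nonneg
  have hdX0 : 0 ≤ dX := by rw [rdX]; exact measureReal_nonneg
  have hdYle : dY ≤ qY := by
    rw [rdY, rqY, ← Du_inter_Y_eq s u v]; exact measureReal_mono fun ω h => ⟨h.1, h.2.2⟩
  have hdXle : dX ≤ qX := by
    rw [rdX, rqX, ← Du_inter_Y_eq s v u]; exact measureReal_mono fun ω h => ⟨h.1, h.2.2⟩
  have upSU : IsUpperSet SU := isUpperSet_openConn s u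
  have upSV : IsUpperSet SV := isUpperSet_openConn s v
  have hc' : (qX + qW) * (qY + qW) ≤ qW := by
    have h := prodBernoulli_harris wF upSU upSV (hmeas _) (hmeas _)
    rw [← hν, xbar, ybar, ← rqW] at h; exact h
  have hxb1 : qX + qW ≤ 1 := by rw [← xbar]; exact measureReal_le_one
  have hyb1 : qY + qW ≤ 1 := by rw [← ybar]; exact measureReal_le_one
  have hub1 : qX + qY + qW ≤ 1 := by rw [← ubar]; exact measureReal_le_one
  have hθu0 : 0 ≤ dY / qY := div_nonneg hdY0 hqY0
  have hθv0 : 0 ≤ dX / qX := div_nonneg hdX0 hqX0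
  have hθu : dY / qY * qY = dY := by
    rcases eq_or_lt_of_le hqY0 with h | h
    · have : dY = 0 := le_antisymm (by rw [h]; exact hdYle) hdY0
      rw [← h, this]; simp
    · exact div_mul_cancel₀ dY (ne_of_gt h)
  have hθv : dX / qX * qX = dX := by
    rcases eq_or_lt_of_le hqX0 with h | h
    · have : dX = 0 := le_antisymm (by rw [h]; exact hdXle) hdX0
      rw [← h, this]; simp
    · exact div_mul_cancel₀ dX (ne_of_gt h)
  have hEu0 : 0 ≤ Eu := measureReal_nonneg
  have hEv0 : 0 ≤ Ev := measureReal_nonneg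
  have hτu0 : 0 ≤ τu := div_nonneg hEu0 (le_of_lt rDu)
  have hτv0 : 0 ≤ τv := div_nonneg hEv0 (le_of_lt rDv)
  have pX : 0 ≤ aX - τu * qX := by
    have := div_row (D := Du) (E := Eu) (P := qX) (R := aX) rDu (by linarith [n1]); linarith
  have pY : 0 ≤ aY - τv * qY := by
    have := div_row (D := Dv) (E := Ev) (P := qY) (R := aY) rDv (by linarith [n2]); linarith
  have pXY : 0 ≤ aW - (τu + τv) * qW := by
    have := div_rows (Du := Du) (Dv := Dv) (Eu := Eu) (Ev := Ev) (P := qW) (Q := qW) (R := aW) rDu rDv (by linarith [n3]); linarith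
  have hθτu : dY / qY ≤ τu := by
    rcases eq_or_lt_of_le hqY0 with h | h
    · rw [← h, div_zero]; exact hτu0
    · rw [hτu, div_le_div_iff₀ h rDu]; linarith [t1]
  have hθτv : dX / qX ≤ τv := by
    rcases eq_or_lt_of_le hqX0 with h | h
    · rw [← h, div_zero]; exact hτv0
    · rw [hτv, div_le_div_iff₀ h rDv]; linarith [t2]
  have rHx' := div_rows (Du := Du) (Dv := Dv) (Eu := Eu) (Ev := Ev) (P := qX + qW - (qX + qW) * (qX + qW)) (Q := qW - (qY + qW) * (qX + qW)) (R := aX + aW - (a0 + aX + aY + aW) * (qX + qW))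
    rDu rDv (by linarith [h4])
  have rHy' := div_rows (Du := Du) (Dv := Dv) (Eu := Eu) (Ev := Ev) (P := qW - (qX + qW) * (qY + qW)) (Q := qY + qW - (qY + qW) * (qY + qW)) (R := aY + aW - (a0 + aX + aY + aW) * (qY + qW))
    rDu rDv (by linarith [h5])
  have rHu' := div_rows (Du := Du) (Dv := Dv) (Eu := Eu) (Ev := Ev) (P := qX + qW - (qX + qW) * (qX + qY + qW)) (Q := qY + qW - (qY + qW) * (qX + qY + qW))
    (R := aX + aY + aW - (a0 + aX + aY + aW) * (qX + qY + qW)) rDu rDv (by linarith [h6])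
  have rHw' := div_rows (Du := Du) (Dv := Dv) (Eu := Eu) (Ev := Ev) (P := qW - (qX + qW) * qW) (Q := qW - (qY + qW) * qW) (R := aW - (a0 + aX + aY + aW) * qW) rDu rDv (by linarith [h7])
  have pack := near_theta_rows (qX := qX) (qY := qY) (w := qW) (a0 := a0) (aX := aX) (aY := aY) (aXY := aW)
    (τx := τu) (τy := τv) (θx := dY / qY) (θy := dX / qX)
    hqX0 hqY0 hqW0 hxb1 hyb1 hub1 hc' ha00 hθτu hθτv pX pY pXY
    (by linarith [rHx']) (by linarith [rHy']) (by linarith [rHu']) (by linarith [rHw'])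
  obtain ⟨q1, q2, q3, -, q5, q6, q7, q8⟩ := pack
  exact ⟨hθu0, hθv0, hθu, hθv, q1, q2, q3, q5, q6, q7, q8⟩

/-- **THEOREM B⁺ conditional on the STAR row alone.**  In the setting of `incStar_nonneg_of_twoCut_rootSideTarget` with `s, u, v` distinct and the
three loner/separation events of the root side non-null, the only hypothesis left on the near side is the STAR row `hN8` for
`u′ = u_A − (dY/qY)·u_u − (dX/qX)·u_v` (the open inequality (N8) ⟸ (V2)); together with the two moved-target stars it gives the increasing star at
`(a, b, c)`. [this work] -/
theorem incStar_nonneg_of_twoCut_rootSideTarget_of_starRow (w : Sym2 (Fin n) → unitInterval) (R : Set (Fin n)) {s u v a b c : Fin n}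
    (hs : s ∈ R) (ha : a ∈ R ∨ a = u ∨ a = v) (hb : b ∉ R) (hc : c ∉ R) (hus : u ≠ s) (hvs : v ≠ s) (huv : u ≠ v)
    (hw : ∀ x ∈ R, ∀ z, z ∉ R → z ≠ u → z ≠ v → w s(x, z) = 0)
    {F : Set (Sym2 (Fin n))} (hF : F = {e : Sym2 (Fin n) | ∃ y ∈ R, y ∈ e})
    {Xu Xv Ba Va Ua : Set (BondConfig (Fin n))}
    (hXu : Xu = {ω | ω ∩ F ∈ (openConn s u : Set (BondConfig (Fin n)))})
    (hXv : Xv = {ω | ω ∩ F ∈ (openConn s v : Set (BondConfig (Fin n)))})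
    (hBa : Ba = {ω | ω ∩ F ∈ (openConn s a : Set (BondConfig (Fin n)))})
    (hVa : Va = {ω | ω ∩ F ∈ (openConn v a : Set (BondConfig (Fin n)))})
    (hUa : Ua = {ω | ω ∩ F ∈ (openConn u a : Set (BondConfig (Fin n)))})
    {qX qY qW a0 aX aY aW dX dY : ℝ}
    (hqX : qX = (prodBernoulli w).real (Xu \ Xv)) (hqY : qY = (prodBernoulli w).real (Xv \ Xu))
    (hqW : qW = (prodBernoulli w).real (Xu ∩ Xv))
    (ha0 : a0 = (prodBernoulli w).real (Ba ∩ (Xu ∪ Xv)ᶜ)) (haX : aX = (prodBernoulli w).real (Ba ∩ (Xu \ Xv)))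
    (haY : aY = (prodBernoulli w).real (Ba ∩ (Xv \ Xu))) (haW : aW = (prodBernoulli w).real (Ba ∩ (Xu ∩ Xv)))
    (hdX : dX = (prodBernoulli w).real ((Ba ∪ Va) ∩ (Xu \ Xv)) - (prodBernoulli w).real (Ba ∩ (Xu \ Xv)))
    (hdY : dY = (prodBernoulli w).real ((Ba ∪ Ua) ∩ (Xv \ Xu)) - (prodBernoulli w).real (Ba ∩ (Xv \ Xu)))
    (hDu : 0 < (prodBernoulli w).real {ω | ω ∩ F ∈ ((openConn u s)ᶜ ∩ (openConn u v)ᶜ : Set (BondConfig (Fin n)))})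
    (hDv : 0 < (prodBernoulli w).real {ω | ω ∩ F ∈ ((openConn v s)ᶜ ∩ (openConn v u)ᶜ : Set (BondConfig (Fin n)))})
    (hD0 : 0 < (prodBernoulli w).real {ω | ω ∩ F ∈ ((openConn s u)ᶜ ∩ (openConn s v)ᶜ ∩ (openConn u v)ᶜ : Set (BondConfig (Fin n)))})
    -- the STAR row for u′ (θu = dY/qY, θv = dX/qX): the open inequality (N8)
    (hN8 : 0 ≤ 2 * (aW - (dY / qY + dX / qX) * qW) - ((aX - dY / qY * qX) + (aW - (dY / qY + dX / qX) * qW)) * (qY + qW)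
      - ((aY - dX / qX * qY) + (aW - (dY / qY + dX / qX) * qW)) * (qX + qW)
      - (qW - (qX + qW) * (qY + qW)) * (a0 + aX + aY + aW - dY / qY * (qX + qW) - dX / qX * (qY + qW)))
    (hMu : 0 ≤ sahiE3 (prodBernoulli w) (openConn s u) (openConn s b) (openConn s c))
    (hMv : 0 ≤ sahiE3 (prodBernoulli w) (openConn s v) (openConn s b) (openConn s c)) :
    0 ≤ sahiE3 (prodBernoulli w) (openConn s a) (openConn s b) (openConn s c) := by
  obtain ⟨h0u, h0v, hθu, hθv, n1, n2, n3, n4, n5, n6, n7⟩ :=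
    twoCut_near_rows w hus hvs huv F hXu hXv hBa hVa hUa hqX hqY hqW ha0 haX haY haW hdX hdY hDu hDv hD0
  exact incStar_nonneg_of_twoCut_rootSideTarget w R hs ha hb hc hw hF hXu hXv hBa hVa hUa hqX hqY hqW ha0 haX haY haW hdX hdY
    h0u h0v hθu hθv n1 n2 n3 n4 n5 n6 n7 hN8 hMu hMv

end NearRows

end IncStarTwoCut

end Summit.CriticalPhenomena.PercolationContinuityZ3.Theorems
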